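import Summits.RiemannHypothesis.RiemannHypothesis.Theorems.GroundBartaPolarPerronFrobeniusEvenFloor
import Summits.RiemannHypothesis.RiemannHypothesis.Theorems.GroundBartaPolarPerronFrobeniusEvenSectorNegativity
import Summits.RiemannHypothesis.RiemannHypothesis.Theorems.GroundBartaGroundBartaFloorRateDecay
import HarnessLib

/-!
# The parity-free deciding theorem of the even sector (route `RiemannHypothesis/GroundBarta`,
rung 3 `PolarPerronFrobenius`, stmt-RiemannHypothesis-18390)

From the EVEN-SECTOR Barta floor (`neg_groundBartaRate_le_weilEvenGroundEnergy`:
one-signed even-sector bottom state at `a` ⇒ `ε_ev(a) ≥ -e(a)`, `e = groundBartaRate → 0`,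
`stub_groundRateDecay`) and EVEN negativity off the line (`evenNegativityOffLine`: `¬RH ⇒`
`ε_ev(a) ≤ -η < 0` on all large windows):

* `riemannHypothesis_of_cofinal_evenSectorOneSigned` — **if beyond every height some window
  carries an even-sector bottom state (`IsWeilEvenGroundState`) that is real and `≥ 0` a.e., then
  RH.**  The hypothesis is WEAKER than "cofinally the FULL windowed form has a one-signed ground
  state" (`PolarPerronFrobenius.riemannHypothesis_of_cofinal_oneSigned`: a one-signed ground state
  can be taken even, and an even full ground state is an even-sector bottom state) and needs no
  parity order (`EvenWinsBeyondArch`, rung 4) at all — not even as the funnel through which the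
  crux `PolarPerronFrobenius` receives its even state: an even one-signed bottom state of the EVEN
  SECTOR suffices whether or not the even sector carries the full bottom.
* `eventually_forall_not_evenSectorOneSigned_of_not_riemannHypothesis` — the contrapositive:
  off RH, beyond some height EVERY even-sector bottom state of EVERY window changes sign.
* Route forms, token for token, of the draft route `EvenSectorBarta` (Theses/EvenSectorBarta.lean):
  `evenBartaFloor_routeForm` = item `EvenBartaFloor` (stmt-RiemannHypothesis-19954, the explicit
  per-window floor), `evenFloorDecay_routeForm` = item `EvenFloorDecay` (stmt-19955), and
  `riemannHypothesis_of_evenOneSignedWindows_routeForm` : `EvenOneSignedWindows → RH` (that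
  route's RH-bearing crux stmt-19953 ALONE decides RH, its other three items being theorems here
  and in Theorems/GroundBartaPolarPerronFrobeniusEvenSectorNegativity.lean).  The printed theta
  series of those statements is identified with `weilThetaPhi` by `evenFloor_inlinePhi_eq`.
RH-free.  References: Bombieri 2000 §4; Barta 1937 via López-Gómez doi:10.1142/8664 p.175;
Yoshida 1992 Prop. 1.
-/

set_option linter.dupNamespace false

noncomputable section

open Set MeasureTheory Filter Complex
open scoped Real Topology ComplexConjugate

namespace Summit.RiemannHypothesis.RiemannHypothesis.Theorems.PolarPerronFrobenius

open Literature.NumberTheory.LFunctions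
open Summit.RiemannHypothesis.RiemannHypothesis.Theorems.GroundBartaFloor

/-! ## The even-sector floor on the even sphere -/

/-- **Even-sector Barta floor, sphere form**: at a window `a > 0` carrying a one-signed
even-sector bottom state, every `L²`-normalised EVEN window test has `Re Q(h) ≥ ε_ev(a) ≥ -e(a)`,
`e = groundBartaRate`. [cite: Bombieri2000Weil, §4 Lemma 1] -/
theorem evenFloor_le_re_weilQuadratic {a : ℝ} (ha : 0 < a) {u : ℝ → ℂ}
    (hu : IsWeilEvenGroundState a u)
    (hsign : ∀ᵐ t : ℝ, t ∈ Ioo (-a) a → (u t).im = 0 ∧ 0 ≤ (u t).re)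
    {h : ℝ → ℂ} (hh : IsWeilTest h) (hs : tsupport h ⊆ Icc (-a) a) (hev : ∀ t, h (-t) = h t)
    (hn : ∫ t, ‖h t‖ ^ 2 = (1 : ℝ)) :
    -groundBartaRate a ≤ (weilQuadratic h).re :=
  (neg_groundBartaRate_le_weilEvenGroundEnergy ha hu hsign).trans (weilEvenGroundEnergy_le hh hs hev hn)

/-- The Barta rate as a function: `groundBartaRate → 0` (`stub_groundRateDecay`, restated on the
name). [folklore] -/
theorem tendsto_groundBartaRate : Tendsto groundBartaRate atTop (𝓝 0) :=
  stub_groundRateDecay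

/-! ## The parity-free deciding theorem -/

/-- **Cofinally one-signed EVEN-SECTOR bottom states decide RH.**  If beyond every height `A`
there is a window `a ≥ A` carrying an even-sector bottom state `u` (`IsWeilEvenGroundState a u`)
with `Im u = 0`, `Re u ≥ 0` a.e. on `(-a, a)`, then the Riemann hypothesis holds: otherwise even
negativity gives `η > 0` with `ε_ev(a) ≤ -η` on all large windows, the rate decays below `η`, and
at a good window beyond both heights the even-sector floor gives `-e(a) ≤ ε_ev(a) ≤ -η < -e(a)`.
No parity-order hypothesis and no statement about the full bottom are used. [folklore] -/
theorem riemannHypothesis_of_cofinal_evenSectorOneSigned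
    (hcof : ∀ A : ℝ, ∃ a : ℝ, A ≤ a ∧ ∃ u : ℝ → ℂ, IsWeilEvenGroundState a u ∧
      (∀ᵐ t : ℝ, t ∈ Ioo (-a) a → (u t).im = 0 ∧ 0 ≤ (u t).re)) :
    RiemannHypothesis := by
  by_contra hRH
  obtain ⟨η, hη, A, hA⟩ := weilEvenGroundEnergy_le_neg_of_not_riemannHypothesis hRH
  obtain ⟨A₁, hA₁⟩ := eventually_atTop.1 (tendsto_groundBartaRate.eventually (Iio_mem_nhds hη))
  obtain ⟨a, ha, u, hu, hsign⟩ := hcof (max (max A A₁) 1)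
  have haA : A ≤ a := le_trans (le_trans (le_max_left _ _) (le_max_left _ _)) ha
  have haA₁ : A₁ ≤ a := le_trans (le_trans (le_max_right _ _) (le_max_left _ _)) ha
  have ha0 : 0 < a := lt_of_lt_of_le one_pos (le_trans (le_max_right _ _) ha)
  have hfloor := neg_groundBartaRate_le_weilEvenGroundEnergy ha0 hu hsign
  have hneg := hA a haA
  have hlt : groundBartaRate a < η := hA₁ a haA₁
  linarith

/-- **Off RH, every even-sector bottom state eventually changes sign**: if RH fails there is a
height `A` such that at every window `a ≥ A` NO even-sector bottom state is real and `≥ 0` a.e. on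
`(-a, a)`. [folklore] -/
theorem eventually_forall_not_evenSectorOneSigned_of_not_riemannHypothesis
    (hRH : ¬ RiemannHypothesis) :
    ∃ A : ℝ, ∀ a : ℝ, A ≤ a → ∀ u : ℝ → ℂ, IsWeilEvenGroundState a u →
      ¬ (∀ᵐ t : ℝ, t ∈ Ioo (-a) a → (u t).im = 0 ∧ 0 ≤ (u t).re) := by
  by_contra hne
  push Not at hne
  refine hRH (riemannHypothesis_of_cofinal_evenSectorOneSigned fun A => ?_)
  obtain ⟨a, ha, u, hu, hsign⟩ := hne A
  exact ⟨a, ha, u, hu, hsign⟩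

/-- **RH or a last good even window**: either RH holds, or there is a height beyond which no
window carries a one-signed even-sector bottom state. [folklore] -/
theorem riemannHypothesis_or_eventually_not_evenSectorOneSigned :
    RiemannHypothesis ∨ ∃ A : ℝ, ∀ a : ℝ, A ≤ a → ∀ u : ℝ → ℂ, IsWeilEvenGroundState a u →
      ¬ (∀ᵐ t : ℝ, t ∈ Ioo (-a) a → (u t).im = 0 ∧ 0 ≤ (u t).re) := by
  by_cases hRH : RiemannHypothesis
  · exact Or.inl hRH
  · exact Or.inr (eventually_forall_not_evenSectorOneSigned_of_not_riemannHypothesis hRH)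

/-! ## Route forms of the draft route `EvenSectorBarta` -/

/-- The printed theta series of `Theses/EvenSectorBarta.lean` is Riemann's kernel `Φ = weilThetaPhi`
(`= 2·deBruijnPhi(t/2)`; reindexing-free, term by term). [cite: RodgersTao2020, eq. (2)] -/
theorem evenFloor_inlinePhi_eq (t : ℝ) :
    (∑' n : ℕ, (4 * Real.pi ^ 2 * ((n : ℝ) + 1) ^ 4 * Real.exp (9 / 2 * t) -
      6 * Real.pi * ((n : ℝ) + 1) ^ 2 * Real.exp (5 / 2 * t)) *
        Real.exp (-(Real.pi * ((n : ℝ) + 1) ^ 2 * Real.exp (2 * t)))) = weilThetaPhi t := by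
  unfold weilThetaPhi deBruijnPhi deBruijnPhiSummand
  rw [← tsum_mul_left]
  refine tsum_congr fun n => ?_
  have h1 : (9 : ℝ) * (t / 2) = 9 / 2 * t := by ring
  have h2 : (5 : ℝ) * (t / 2) = 5 / 2 * t := by ring
  have h3 : (4 : ℝ) * (t / 2) = 2 * t := by ring
  rw [h1, h2, h3]
  ring

/-- The printed theta series, as a function, is `weilThetaPhi`. [folklore] -/
theorem evenFloor_inlinePhi_eq_fun :
    (fun t : ℝ => ∑' n : ℕ, (4 * Real.pi ^ 2 * ((n : ℝ) + 1) ^ 4 * Real.exp (9 / 2 * t) -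
      6 * Real.pi * ((n : ℝ) + 1) ^ 2 * Real.exp (5 / 2 * t)) *
        Real.exp (-(Real.pi * ((n : ℝ) + 1) ^ 2 * Real.exp (2 * t)))) = weilThetaPhi :=
  funext evenFloor_inlinePhi_eq

/-- **Route form of item `EvenBartaFloor` (draft route `EvenSectorBarta`,
stmt-RiemannHypothesis-19954), token for token**: for every `a > 0`, if some even-sector bottom
state at `a` is real and `≥ 0` a.e. on `(-a, a)`, then every even `L²`-normalised smooth test `h`
supported in `[-a, a]` has `-e(a) ≤ Re Q h`, with the EXPLICIT rate
`e(a) = 2(∫_{s>a} Φ(s)·2cosh(s/2) ds)·cosh(a/2)/Φ(a)` spelled through the printed theta series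
(`= groundBartaRate a` by `evenFloor_inlinePhi_eq`).  Closable in that route by `exact` this.
[cite: Bombieri2000Weil, §4 Lemma 1] -/
theorem evenBartaFloor_routeForm :
    (let C : (ℝ → ℂ) → ℝ → ℂ := fun g => MeasureTheory.convolution g (fun t => (starRingEnd ℂ) (g (-t))) (ContinuousLinearMap.mul ℂ ℂ) MeasureTheory.MeasureSpace.volume; let M : (ℝ → ℂ) → ℂ → ℂ := fun F s => ∫ t : ℝ, F t * Complex.exp ((s - 1 / 2) * t); let Q : (ℝ → ℂ) → ℂ := fun g => M (C g) 0 + M (C g) 1 - (∑' n : ℕ, ((ArithmeticFunction.vonMangoldt n : ℝ) : ℂ) / (Real.sqrt n : ℂ) * (C g (Real.log n) + C g (-Real.log n))) + ((1 / (2 * Real.pi) : ℂ) * (∫ t : ℝ, M (C g) (1 / 2 + t * Complex.I) * ((Complex.digamma (1 / 4 + t / 2 * Complex.I)).re : ℂ)) - C g 0 * (Real.log Real.pi : ℂ)); let Φ : ℝ → ℝ := fun t => ∑' n : ℕ, (4 * Real.pi ^ 2 * ((n : ℝ) + 1) ^ 4 * Real.exp (9 / 2 * t) - 6 * Real.pi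 * ((n : ℝ) + 1) ^ 2 * Real.exp (5 / 2 * t)) * Real.exp (-(Real.pi * ((n : ℝ) + 1) ^ 2 * Real.exp (2 * t))); let e : ℝ → ℝ := fun a => 2 * (∫ s in Set.Ioi a, Φ s * (2 * Real.cosh (s / 2))) * Real.cosh (a / 2) / Φ a; ∀ a : ℝ, 0 < a → (∃ u : ℝ → ℂ, (MeasureTheory.MemLp u 2 ∧ ∃ g : ℕ → ℝ → ℂ, (∀ n, (ContDiff ℝ ((⊤ : ℕ∞) : WithTop ℕ∞) (g n) ∧ HasCompactSupport (g n)) ∧ tsupport (g n) ⊆ Set.Icc (-a) a ∧ (∀ t, g n (-t) = g n t) ∧ ∫ t, ‖g n t‖ ^ 2 = (1 : ℝ)) ∧ (∀ h : ℝ → ℂ, (ContDiff ℝ ((⊤ : ℕ∞) : WithTop ℕ∞) h ∧ HasCompactSupport h) → tsupport h ⊆ Set.Icc (-a) a → (∀ t, h (-t) = h t) → ∫ t, ‖h t‖ ^ 2 = (1 : ℝ) → ∀ δ : ℝ, 0 < δ → ∀ᶠ n in Filter.atTop, (Q (g n)).re ≤ (Q h).re + δ) ∧ Filter.Tendsto (fun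 n => ∫ t, ‖g n t - u t‖ ^ 2) Filter.atTop (nhds 0)) ∧ (∀ᵐ t : ℝ, t ∈ Set.Ioo (-a) a → (u t).im = 0 ∧ 0 ≤ (u t).re)) → ∀ h : ℝ → ℂ, (ContDiff ℝ ((⊤ : ℕ∞) : WithTop ℕ∞) h ∧ HasCompactSupport h) → tsupport h ⊆ Set.Icc (-a) a → (∀ t, h (-t) = h t) → ∫ t, ‖h t‖ ^ 2 = (1 : ℝ) → -e a ≤ (Q h).re) := by
  intro C M Q Φ e a ha hex h hh hs hev hn
  have hΦ : Φ = weilThetaPhi := evenFloor_inlinePhi_eq_fun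
  obtain ⟨u, hu, hsign⟩ := hex
  have hu' : IsWeilEvenGroundState a u := hu
  have key : -groundBartaRate a ≤ (weilQuadratic h).re :=
    evenFloor_le_re_weilQuadratic ha hu' hsign hh hs hev hn
  have hE : e a = groundBartaRate a := by
    show 2 * (∫ s in Set.Ioi a, Φ s * (2 * Real.cosh (s / 2))) * Real.cosh (a / 2) / Φ a =
      groundBartaRate a
    rw [hΦ]
    rfl
  show -e a ≤ (weilQuadratic h).re
  rw [hE]
  exact key

/-- **Route form of item `EvenFloorDecay` (draft route `EvenSectorBarta`,
stmt-RiemannHypothesis-19955), token for token**: the explicit Barta rate, spelled through the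
printed theta series, tends to `0` (`stub_groundRateDecay` after `evenFloor_inlinePhi_eq`). [folklore] -/
theorem evenFloorDecay_routeForm :
    (let Φ : ℝ → ℝ := fun t => ∑' n : ℕ, (4 * Real.pi ^ 2 * ((n : ℝ) + 1) ^ 4 * Real.exp (9 / 2 * t) - 6 * Real.pi * ((n : ℝ) + 1) ^ 2 * Real.exp (5 / 2 * t)) * Real.exp (-(Real.pi * ((n : ℝ) + 1) ^ 2 * Real.exp (2 * t))); let e : ℝ → ℝ := fun a => 2 * (∫ s in Set.Ioi a, Φ s * (2 * Real.cosh (s / 2))) * Real.cosh (a / 2) / Φ a; Filter.Tendsto e Filter.atTop (nhds 0)) := by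
  intro Φ e
  have hΦ : Φ = weilThetaPhi := evenFloor_inlinePhi_eq_fun
  have hE : e = groundBartaRate := by
    funext a
    show 2 * (∫ s in Set.Ioi a, Φ s * (2 * Real.cosh (s / 2))) * Real.cosh (a / 2) / Φ a =
      groundBartaRate a
    rw [hΦ]
    rfl
  show Tendsto e atTop (nhds 0)
  rw [hE]
  exact tendsto_groundBartaRate

/-- **The RH-bearing crux of the draft route `EvenSectorBarta` ALONE decides RH**: the statement
of item `EvenOneSignedWindows` (stmt-RiemannHypothesis-19953), token for token (it inlines
`IsWeilEvenGroundState`, `isWeilEvenGroundState_iff_inline`), implies the Riemann hypothesis —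
that route's items `EvenBartaFloor`, `EvenFloorDecay`, `EvenNegativityOffLine` being theorems
(`evenBartaFloor_routeForm`, `evenFloorDecay_routeForm`, `evenNegativityOffLine_routeForm`).
[folklore] -/
theorem riemannHypothesis_of_evenOneSignedWindows_routeForm
    (hPos : let C : (ℝ → ℂ) → ℝ → ℂ := fun g => MeasureTheory.convolution g (fun t => (starRingEnd ℂ) (g (-t))) (ContinuousLinearMap.mul ℂ ℂ) MeasureTheory.MeasureSpace.volume; let M : (ℝ → ℂ) → ℂ → ℂ := fun F s => ∫ t : ℝ, F t * Complex.exp ((s - 1 / 2) * t); let Q : (ℝ → ℂ) → ℂ := fun g => M (C g) 0 + M (C g) 1 - (∑' n : ℕ, ((ArithmeticFunction.vonMangoldt n : ℝ) : ℂ) / (Real.sqrt n : ℂ) * (C g (Real.log n) + C g (-Real.log n))) + ((1 / (2 * Real.pi) : ℂ) * (∫ t : ℝ, M (C g) (1 / 2 + t * Complex.I) * ((Complex.digamma (1 / 4 + t / 2 * Complex.I)).re : ℂ)) - C g 0 * (Real.log Real.pi : ℂ)); ∀ A : ℝ, ∃ a : ℝ, A ≤ a ∧ ∃ u : ℝ →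 ℂ, (MeasureTheory.MemLp u 2 ∧ ∃ g : ℕ → ℝ → ℂ, (∀ n, (ContDiff ℝ ((⊤ : ℕ∞) : WithTop ℕ∞) (g n) ∧ HasCompactSupport (g n)) ∧ tsupport (g n) ⊆ Set.Icc (-a) a ∧ (∀ t, g n (-t) = g n t) ∧ ∫ t, ‖g n t‖ ^ 2 = (1 : ℝ)) ∧ (∀ h : ℝ → ℂ, (ContDiff ℝ ((⊤ : ℕ∞) : WithTop ℕ∞) h ∧ HasCompactSupport h) → tsupport h ⊆ Set.Icc (-a) a → (∀ t, h (-t) = h t) → ∫ t, ‖h t‖ ^ 2 = (1 : ℝ) → ∀ δ : ℝ, 0 < δ → ∀ᶠ n in Filter.atTop, (Q (g n)).re ≤ (Q h).re + δ) ∧ Filter.Tendsto (fun n => ∫ t, ‖g n t - u t‖ ^ 2) Filter.atTop (nhds 0)) ∧ (∀ᵐ t : ℝ, t ∈ Set.Ioo (-a) a → (u t).im = 0 ∧ 0 ≤ (u t).re)) :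
    RiemannHypothesis := by
  refine riemannHypothesis_of_cofinal_evenSectorOneSigned fun A => ?_
  obtain ⟨a, ha, u, hu, hsign⟩ := hPos A
  exact ⟨a, ha, u, hu, hsign⟩

end Summit.RiemannHypothesis.RiemannHypothesis.Theorems.PolarPerronFrobenius

end
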